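import Summits.HodgeConjecture.HodgeConjecture.Theorems.HodgeLocusCensusQuarticTwoBlockRows
import Summits.HodgeConjecture.HodgeConjecture.Theorems.HodgeLocusCensusQuarticCertStackTwo
import Summits.HodgeConjecture.HodgeConjecture.Theorems.HodgeLocusCensusQuarticCertStackStdTwist
import HarnessLib

/-!
# HodgeLocusCensusQuarticStackedRows — intdim⁴₆(1) = 37 as the rank of the STACKED single-plane period matrices, for the two-block pair and for
the standard pair (cell pub-hlocus, LEAD seat ivhs-1, gen 6)
HONEST FRAMING: certified instances and evidence bearing on the general Hodge conjecture; no claim.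

For a pair of 3-planes P, P′ of the Fermat quartic sixfold the Zariski tangent space of the Hodge locus V_{[P]} (resp. V_{[P′]}) at the Fermat point
is the kernel of the single-plane period matrix M_P (resp. M_{P′}) [Movasati2016Periods, Thm. 6], so the codimension of their INTERSECTION is
rank [M_P ; M_{P′}] (the two matrices stacked, `Matrix.fromRows`). This file certifies rank [M_{P0} ; M_{Ptwo}] = 37 (`stackRank_std_twoBlock`) and
rank [M_{P0} ; M_{P̌₁}] = 37 (`stackRank_std_stdTwist`) over every characteristic-0 field with a primitive 8th root of unity — both equal to
Movasati's printed intdim⁴₆(1) = 37 [Movasati2016Periods, Thm. 13] (`QuarticTwoBlock.intdim_6_4_1`). Side by side with the class rows of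
`HodgeLocusCensusQuarticTwoBlockRows`: rank M_{[P0]+[Ptwo]} = 37 = rank [M_{P0} ; M_{Ptwo}] (`twoBlock_rank_eq_stackRank`: since each row of the
class matrix is the sum of the corresponding rows of the stacked matrix, its kernel contains the intersection of the two tangent spaces, and equal
rank makes it EQUAL to it — the EXPLAINED-SMOOTH reading of `explainedSmooth_6_4_1_twoBlock` at tangent level), while rank M_{[P0]+[P̌₁]} + 1 = 37
(`std_rank_add_one_eq_stackRank`: for the standard pair the tangent space of the Hodge locus of the sum is a hyperplane-LARGER space than the
intersection — the (6,4,1 | 36, 37) line of Movasati's five-tuple table with both numbers kernel-certified).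
Certificates: `HodgeLocusCensusQuarticCertStackTwoA/…StackTwo`, `…StackStdTwistA/…StackStdTwist` (two (U) chunks each, `Z8Cert.Cert.validU_append`),
soundness `QDense.stackRank_of_qcert`. Numerics (two implementations): t41/rank64.py exact elimination over ℚ(ζ₈) (37 = 2+8+17+8+2 both) = the
ℤ[ζ₈] certificates of t41/gen64.py re-multiplied by the kernel.
-/

namespace Summit.HodgeConjecture.HodgeConjecture.HodgeLocus.Census.QuarticTwoBlock

open PlaneSum Z8Cert QDense TwistCells

/-! ## intdim⁴₆(1) = 37 as the rank of the STACKED single-plane matrices (codimension of the intersection of the two tangent spaces) -/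

/-- rank [M_{P0} ; M_{Ptwo}] = 37: the Zariski tangent spaces of V_{P0} and V_{Ptwo} at the Fermat point meet in codimension 37 = intdim⁴₆(1). -/
theorem stackRank_std_twoBlock : ∀ (K : Type) [Field K] [CharZero K] (ζ : K), IsPrimitiveRoot ζ (2 * 4) →
    (Matrix.fromRows (ivhsMatrix 6 4 ζ [(1, standardP 6)]) (ivhsMatrix 6 4 ζ [(1, twoBlockP6)])).rank = 37 :=
  stackRank_of_qcert planeStdL planeTwoL (by decide) (by decide) _ _ (fun _ _ ζ h4 i => periodComb_std ζ h4 i)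
    (fun _ _ ζ h4 i => periodComb_two ζ h4 i) stackTwoCert stackTwo_valid

/-- rank [M_{P0} ; M_{P̌₁}] = 37 for the standard pair as well (so its class rank 36 is one less than the tangent-space intersection codimension). -/
theorem stackRank_std_stdTwist : ∀ (K : Type) [Field K] [CharZero K] (ζ : K), IsPrimitiveRoot ζ (2 * 4) →
    (Matrix.fromRows (ivhsMatrix 6 4 ζ [(1, standardP 6)]) (ivhsMatrix 6 4 ζ [(1, standardPc 6 1 1)])).rank = 37 :=
  stackRank_of_qcert planeStdL planeStdTwistL (by decide) (by decide) _ _ (fun _ _ ζ h4 i => periodComb_std ζ h4 i)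
    (fun _ _ ζ h4 i => periodComb_stdTwist ζ h4 i) stackStdTwistCert stackStdTwist_valid


/-- side by side: for the two-block pair the class matrix and the stacked matrix have the same rank … -/
theorem twoBlock_rank_eq_stackRank : ∀ (K : Type) [Field K] [CharZero K] (ζ : K), IsPrimitiveRoot ζ (2 * 4) →
    (ivhsMatrix 6 4 ζ [(1, standardP 6), (1, twoBlockP6)]).rank =
      (Matrix.fromRows (ivhsMatrix 6 4 ζ [(1, standardP 6)]) (ivhsMatrix 6 4 ζ [(1, twoBlockP6)])).rank := by
  intro K _ _ ζ hζ
  rw [ivhsRankEq_twoSum K ζ hζ, stackRank_std_twoBlock K ζ hζ]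

/-- … while for the standard pair the class matrix has rank one less than the stacked matrix (36 + 1 = 37). -/
theorem std_rank_add_one_eq_stackRank : ∀ (K : Type) [Field K] [CharZero K] (ζ : K), IsPrimitiveRoot ζ (2 * 4) →
    (ivhsMatrix 6 4 ζ [(1, standardP 6), (1, standardPc 6 1 1)]).rank + 1 =
      (Matrix.fromRows (ivhsMatrix 6 4 ζ [(1, standardP 6)]) (ivhsMatrix 6 4 ζ [(1, standardPc 6 1 1)])).rank := by
  intro K _ _ ζ hζ
  rw [ivhsRankEq_stdSum K ζ hζ, stackRank_std_stdTwist K ζ hζ]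

end Summit.HodgeConjecture.HodgeConjecture.HodgeLocus.Census.QuarticTwoBlock
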